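import Summits.ABC.StewartYu.DescentIntegralityThirdQ
import Literature.NumberTheory.Transcendental.Waldschmidt1980SizeHyp
import HarnessLib

/-!
# Cell abc-stewartyu, W80Two (xii): RAW archimedean sizes of the factors of the triadic cores —
# record-free, under Waldschmidt's size hypotheses on the flattening

`Summits/ABC/StewartYu/DescentSizesThirdQ.lean` — cell `abc-stewartyu` (seat p2; crux `W80Two`
stmt-ABC-19486), sequel to `DescentIntegralityThirdQ.lean`.  Theorems only; no named fact; NO parameter
record: for `Q : SetupQ` with the height link `hy : Q.flat.SizeHyp V Vθ W` (`log H(αⱼ) ≤ Vⱼ`,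
`log H(θ) ≤ V_θ`, `|bⱼ|, |b_θ| ≤ e^W`) and an unknown `u` in the box of level `J` of the TRIADIC descent
(`λⱼ ≤ Lⱼ/3ᴶ`, `λ_θ ≤ L_θ/3ᴶ`), the factors of `qTerm3 = qΔ3 · qA♭ · qE` and of the third-point weight
`qΔ3_{J+1} · qA♭ · qEt` are bounded by EXPLICIT majorants in `(L, L_θ, S₀, s, τ, V, V_θ, W)`:

* `expn_le_of_mem_box3` — `expnᵢ(u,s) ≤ c · Lallᵢ · S₀` for `s ≤ 3ᴶ · (c · S₀)` (`Lall = Fin.snoc L L_θ`);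
* `abs_flat_γ_le_of_box3` — `|γⱼ(u)| ≤ (Lⱼ + L_θ) · e^W`; `abs_flat_qA_le_of_box3` —
  `|qA♭(u,τ')| ≤ ((Lmax + L_θ) e^W)^{|τ'|}` for a common bound `Lⱼ ≤ Lmax`;
* `abs_qE_le_exp_of_box3` — `|qE(u,s)| ≤ exp(∑ᵢ (c Lallᵢ S₀) Vallᵢ)`; `abs_qEt_le_exp_of_box3` — the same
  bound for the third-point factor `qEt = ∏ allᵢ^{⌊expnᵢ/3⌋}`;
* `den_part_Dclear3_le_exp` — the denominator part of `Dclear3_J` is `≤ exp(∑ᵢ (c Lallᵢ S₀) Vallᵢ)` for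
  `s ≤ 3ᴶ(c S₀)`; `cast_Dclear3_le` — `Dclear3_J(s,τ) ≤ ν(h)^{τ₀} · e^{|τ'| W} · exp(∑ᵢ (c Lallᵢ S₀) Vallᵢ)`.

The parameter record (p1's `PadicW80Par3*`) compares these majorants with its `𝔔3`/`Efac3` closed forms
(`nu_pow_le_𝔔3`, `sum_eV3_le`, …). [folklore] bookkeeping on [Waldschmidt1980, §3.3–3.4].
-/

noncomputable section

open Finset
open Literature.NumberTheory.Transcendental
open Literature.NumberTheory.Transcendental.CW77
open Literature.NumberTheory.Transcendental.CW77.Setup (Idx Tau tauNorm)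
open Literature.NumberTheory.Transcendental.Waldschmidt1980 (nu nu_pos)

namespace Summit.ABC.StewartYu

namespace SetupQ

variable (Q : SetupQ) {h Lb : ℕ}

/-! ### Exponents on the box of level `J` -/

/-- **The exponents on the box of level `J` at a point `s ≤ 3ᴶ · c · S₀` are `≤ c · Lallᵢ · S₀`**
(`⌊L/3ᴶ⌋ · 3ᴶ ≤ L`). [folklore] -/
theorem expn_le_of_mem_box3 {L : Fin Q.d → ℕ} {Lθ J c S₀ : ℕ} {u : Idx Q.d h Lb}
    (hu : u ∈ Q.box3 (h := h) (Lb := Lb) L Lθ J) {s : ℕ} (hs : s ≤ 3 ^ J * (c * S₀))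
    (i : Fin (Q.d + 1)) : Q.flat.expn u s i ≤ c * (Fin.snoc L Lθ : Fin (Q.d + 1) → ℕ) i * S₀ := by
  rw [Q.mem_box3] at hu
  have hdiv : ∀ (lam Lq : ℕ), lam ≤ Lq / 3 ^ J → lam * s ≤ c * Lq * S₀ := by
    intro lam Lq hl
    calc lam * s ≤ (Lq / 3 ^ J) * (3 ^ J * (c * S₀)) := Nat.mul_le_mul hl hs
      _ = ((Lq / 3 ^ J) * 3 ^ J) * (c * S₀) := by ring
      _ ≤ Lq * (c * S₀) := Nat.mul_le_mul_right _ (Nat.div_mul_le_self Lq (3 ^ J))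
      _ = c * Lq * S₀ := by ring
  refine Fin.lastCases ?_ (fun j => ?_) i
  · rw [Q.flat_expn_last, Fin.snoc_last]; exact hdiv _ _ hu.2
  · rw [Q.flat_expn_castSucc, Fin.snoc_castSucc]; exact hdiv _ _ (hu.1 j)

variable {Q}
variable {V : Fin Q.d → ℝ} {Vθ W : ℝ} (hy : Q.flat.SizeHyp V Vθ W)
include hy

/-! ### The linear-form factor `qA♭` -/

/-- **`|γⱼ(u)| ≤ (Lⱼ + L_θ) · e^W`** on the box of level `J` (`λⱼ ≤ Lⱼ`, `λ_θ ≤ L_θ`, `|βⱼ| ≤ e^W`,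
`1 ≤ e^W`). [cite: Waldschmidt1980, §3.3 (p. 268)] -/
theorem abs_flat_γ_le_of_box3 {L : Fin Q.d → ℕ} {Lθ J : ℕ} {u : Idx Q.d h Lb}
    (hu : u ∈ Q.box3 (h := h) (Lb := Lb) L Lθ J) (hW : 0 ≤ W) (j : Fin Q.d) :
    |(Q.flat.γ u j : ℝ)| ≤ ((L j : ℝ) + Lθ) * Real.exp W := by
  rw [Q.mem_box3] at hu
  unfold CW77.Setup.γ
  push_cast
  have h1 : (u.2.1 j : ℝ) ≤ L j := by exact_mod_cast (hu.1 j).trans (Nat.div_le_self _ _)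
  have h2 : (u.2.2 : ℝ) ≤ Lθ := by exact_mod_cast hu.2.trans (Nat.div_le_self _ _)
  have hW1 : 1 ≤ Real.exp W := Real.one_le_exp hW
  have hL0 : (0 : ℝ) ≤ L j := Nat.cast_nonneg _
  have hβ := hy.abs_β_le j
  calc |(u.2.1 j : ℝ) + (u.2.2 : ℝ) * (Q.flat.β j : ℝ)| ≤ |(u.2.1 j : ℝ)| + |(u.2.2 : ℝ) * (Q.flat.β j : ℝ)| :=
        abs_add_le _ _
    _ = (u.2.1 j : ℝ) + (u.2.2 : ℝ) * |(Q.flat.β j : ℝ)| := by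
        rw [abs_mul, Nat.abs_cast, Nat.abs_cast]
    _ ≤ L j * Real.exp W + Lθ * Real.exp W := by
        refine add_le_add ?_ (mul_le_mul h2 hβ (abs_nonneg _) (Nat.cast_nonneg _))
        nlinarith
    _ = ((L j : ℝ) + Lθ) * Real.exp W := by ring

/-- **`|qA♭(u, τ')| ≤ ((Lmax + L_θ) · e^W)^{|τ'|}`** on the box of level `J`, for a common bound
`Lⱼ ≤ Lmax`. [cite: Waldschmidt1980, §3.3 (proof of Lemma 3.3, p. 268)] -/
theorem abs_flat_qA_le_of_box3 {L : Fin Q.d → ℕ} {Lθ J : ℕ} {u : Idx Q.d h Lb}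
    (hu : u ∈ Q.box3 (h := h) (Lb := Lb) L Lθ J) (hW : 0 ≤ W) {Lmax : ℝ} (hL : ∀ j, (L j : ℝ) ≤ Lmax)
    (τ' : Fin Q.d → ℕ) :
    |(Q.flat.qA u τ' : ℝ)| ≤ ((Lmax + Lθ) * Real.exp W) ^ (∑ j, τ' j) := by
  set Γ := (Lmax + Lθ) * Real.exp W with hΓ
  have hγ : ∀ j, |(Q.flat.γ u j : ℝ)| ≤ Γ := fun j =>
    (abs_flat_γ_le_of_box3 hy hu hW j).trans
      (mul_le_mul_of_nonneg_right (by linarith [hL j]) (Real.exp_pos W).le)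
  unfold CW77.Setup.qA; push_cast
  rw [abs_prod]
  calc ∏ j, |(Q.flat.γ u j : ℝ) ^ τ' j| = ∏ j, |(Q.flat.γ u j : ℝ)| ^ τ' j :=
        prod_congr rfl fun j _ => abs_pow _ _
    _ ≤ ∏ j, Γ ^ τ' j := prod_le_prod (fun j _ => by positivity)
        fun j _ => pow_le_pow_left₀ (abs_nonneg _) (hγ j) _
    _ = Γ ^ ∑ j, τ' j := prod_pow_eq_pow_sum _ _ _

/-! ### Height factors -/

/-- **`∏ H(all♭ᵢ)^{eᵢ} ≤ exp(∑ eᵢ Vallᵢ)`** (`Vall = (V, V_θ)`). [cite: Waldschmidt1980, (3.11) (p. 265)] -/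
theorem prod_hgt_pow_le_exp (e : Fin (Q.d + 1) → ℕ) :
    ∏ i, hgt (Q.flat.all i) ^ e i ≤ Real.exp (∑ i, (e i : ℝ) * (Fin.snoc V Vθ : Fin (Q.d + 1) → ℝ) i) := by
  rw [Real.exp_sum]
  exact prod_le_prod (fun i _ => pow_nonneg (hgt_pos _).le _) fun i _ => hy.hgt_pow_le i (e i)

/-- **`|qE(u, s)| ≤ exp(∑ᵢ expnᵢ(u,s) · Vallᵢ)`** (signed cores, through the flattening). [folklore] -/
theorem abs_qE_le_exp (u : Idx Q.d h Lb) (s : ℕ) :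
    |(Q.qE u s : ℝ)| ≤ Real.exp (∑ i, (Q.flat.expn u s i : ℝ) * (Fin.snoc V Vθ : Fin (Q.d + 1) → ℝ) i) := by
  rw [← Rat.cast_abs, Q.abs_qE]
  have hall : ((Q.flat.qE u s : ℚ) : ℝ) = ∏ i, ((Q.flat.all i : ℚ) : ℝ) ^ Q.flat.expn u s i := by
    have e : Q.flat.qE u s = ∏ i, Q.flat.all i ^ Q.flat.expn u s i := by
      unfold CW77.Setup.qE CW77.Setup.all
      rw [Fin.prod_univ_castSucc]
      simp only [Q.flat_expn_castSucc, Q.flat_expn_last, Fin.snoc_castSucc, Fin.snoc_last]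
    rw [e]; push_cast; rfl
  rw [hall]
  refine le_trans ?_ (prod_hgt_pow_le_exp hy _)
  refine prod_le_prod (fun i _ => pow_nonneg (by exact_mod_cast (Q.flat.all_pos i).le) _) fun i _ => ?_
  exact pow_le_pow_left₀ (by exact_mod_cast (Q.flat.all_pos i).le) (self_le_hgt _) _

/-- **`|qEt(u, s)| ≤ exp(∑ᵢ expnᵢ(u,s) · Vallᵢ)`** (the third-point factor; `⌊expnᵢ/3⌋ ≤ expnᵢ`). [folklore] -/
theorem abs_qEt_le_exp (u : Idx Q.d h Lb) (s : ℕ) :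
    |(Q.qEt u s : ℝ)| ≤ Real.exp (∑ i, (Q.flat.expn u s i : ℝ) * (Fin.snoc V Vθ : Fin (Q.d + 1) → ℝ) i) := by
  rw [← Rat.cast_abs, Q.abs_qEt]
  push_cast
  refine le_trans ?_ (prod_hgt_pow_le_exp hy _)
  refine prod_le_prod (fun i _ => pow_nonneg (by exact_mod_cast (Q.flat.all_pos i).le) _) fun i _ => ?_
  calc ((Q.flat.all i : ℚ) : ℝ) ^ (Q.flat.expn u s i / 3) ≤ (hgt (Q.flat.all i)) ^ (Q.flat.expn u s i / 3) :=
        pow_le_pow_left₀ (by exact_mod_cast (Q.flat.all_pos i).le) (self_le_hgt _) _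
    _ ≤ hgt (Q.flat.all i) ^ Q.flat.expn u s i :=
        pow_le_pow_right₀ (one_le_hgt _) (Nat.div_le_self _ _)

omit hy in
/-- **`exp(∑ expnᵢ Vallᵢ) ≤ exp(∑ (c Lallᵢ S₀) Vallᵢ)`** on the box of level `J` for `s ≤ 3ᴶ(c S₀)`
(`Vallᵢ ≥ 0`). [folklore] -/
theorem exp_sum_expn_le_of_box3 {L : Fin Q.d → ℕ} {Lθ J c S₀ : ℕ} {u : Idx Q.d h Lb}
    (hu : u ∈ Q.box3 (h := h) (Lb := Lb) L Lθ J) {s : ℕ} (hs : s ≤ 3 ^ J * (c * S₀))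
    (hV : ∀ i, 0 ≤ (Fin.snoc V Vθ : Fin (Q.d + 1) → ℝ) i) :
    Real.exp (∑ i, (Q.flat.expn u s i : ℝ) * (Fin.snoc V Vθ : Fin (Q.d + 1) → ℝ) i) ≤
      Real.exp (∑ i, ((c * (Fin.snoc L Lθ : Fin (Q.d + 1) → ℕ) i * S₀ : ℕ) : ℝ) * (Fin.snoc V Vθ : Fin (Q.d + 1) → ℝ) i) := by
  refine Real.exp_le_exp.mpr (sum_le_sum fun i _ => ?_)
  exact mul_le_mul_of_nonneg_right (by exact_mod_cast Q.expn_le_of_mem_box3 hu hs i) (hV i)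

/-! ### The clearing denominator -/

/-- **The denominator part of `Dclear3_J(s,τ)` is `≤ exp(∑ᵢ (c Lallᵢ S₀) Vallᵢ)`** for `s ≤ 3ᴶ(c S₀)`
(`den q ≤ H(q)`, `⌊Lⱼ/3ᴶ⌋ s ≤ c Lⱼ S₀`). [cite: Waldschmidt1980, (3.11) (p. 265)] -/
theorem den_part_Dclear3_le_exp {L : Fin Q.d → ℕ} {Lθ J c S₀ s : ℕ} (hs : s ≤ 3 ^ J * (c * S₀)) :
    (((∏ j, (Q.α j).den ^ (L j / 3 ^ J * s)) * Q.θ.den ^ (Lθ / 3 ^ J * s) : ℕ) : ℝ) ≤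
      Real.exp (∑ i, ((c * (Fin.snoc L Lθ : Fin (Q.d + 1) → ℕ) i * S₀ : ℕ) : ℝ) * (Fin.snoc V Vθ : Fin (Q.d + 1) → ℝ) i) := by
  set e' : Fin (Q.d + 1) → ℕ := Fin.snoc (fun j => L j / 3 ^ J * s) (Lθ / 3 ^ J * s) with he'
  have hall : (((∏ j, (Q.α j).den ^ (L j / 3 ^ J * s)) * Q.θ.den ^ (Lθ / 3 ^ J * s) : ℕ) : ℝ) =
      ∏ i, ((Q.flat.all i).den : ℝ) ^ e' i := by
    push_cast
    rw [Fin.prod_univ_castSucc]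
    unfold CW77.Setup.all
    simp only [he', Fin.snoc_castSucc, Fin.snoc_last, Rat.den_abs_eq_den]
  rw [hall]
  have hdiv : ∀ Lq : ℕ, Lq / 3 ^ J * s ≤ c * Lq * S₀ := by
    intro Lq
    calc Lq / 3 ^ J * s ≤ (Lq / 3 ^ J) * (3 ^ J * (c * S₀)) := Nat.mul_le_mul_left _ hs
      _ = ((Lq / 3 ^ J) * 3 ^ J) * (c * S₀) := by ring
      _ ≤ Lq * (c * S₀) := Nat.mul_le_mul_right _ (Nat.div_mul_le_self Lq (3 ^ J))
      _ = c * Lq * S₀ := by ring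
  have he'' : ∀ i, e' i ≤ c * (Fin.snoc L Lθ : Fin (Q.d + 1) → ℕ) i * S₀ := by
    intro i
    refine Fin.lastCases ?_ (fun j => ?_) i
    · simp only [he', Fin.snoc_last]; exact hdiv _
    · simp only [he', Fin.snoc_castSucc]; exact hdiv _
  have hV0 : ∀ i, 0 ≤ (Fin.snoc V Vθ : Fin (Q.d + 1) → ℝ) i := fun i =>
    le_trans (Real.log_nonneg (one_le_hgt _)) (hy.log_hgt_all_le i)
  calc ∏ i, ((Q.flat.all i).den : ℝ) ^ e' i ≤ ∏ i, hgt (Q.flat.all i) ^ e' i :=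
        prod_le_prod (fun i _ => by positivity) fun i _ =>
          pow_le_pow_left₀ (by positivity) (den_le_hgt _) _
    _ ≤ Real.exp (∑ i, (e' i : ℝ) * (Fin.snoc V Vθ : Fin (Q.d + 1) → ℝ) i) := prod_hgt_pow_le_exp hy e'
    _ ≤ _ := Real.exp_le_exp.mpr (sum_le_sum fun i _ =>
        mul_le_mul_of_nonneg_right (by exact_mod_cast he'' i) (hV0 i))

/-- **`Dclear3_J(s,τ) ≤ ν(h)^{τ₀} · e^{|τ'| W} · exp(∑ᵢ (c Lallᵢ S₀) Vallᵢ)`** for `s ≤ 3ᴶ(c S₀)`.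
[cite: Waldschmidt1980, Lemma 3.4 (p. 269)] -/
theorem cast_Dclear3_le {L : Fin Q.d → ℕ} {Lθ J c S₀ s : ℕ} (hs : s ≤ 3 ^ J * (c * S₀)) (τ : Tau Q.d) :
    ((Q.Dclear3 (h := h) J L Lθ s τ : ℕ) : ℝ) ≤
      (nu h : ℝ) ^ τ.1 * Real.exp ((∑ j, τ.2 j : ℕ) * W) *
        Real.exp (∑ i, ((c * (Fin.snoc L Lθ : Fin (Q.d + 1) → ℕ) i * S₀ : ℕ) : ℝ) * (Fin.snoc V Vθ : Fin (Q.d + 1) → ℝ) i) := by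
  unfold Dclear3
  rw [Nat.cast_mul, Nat.cast_mul, Nat.cast_pow]
  have h1 := hy.natAbs_bθ_pow_le_exp (∑ j, τ.2 j)
  have h2 := den_part_Dclear3_le_exp hy (L := L) (Lθ := Lθ) (J := J) hs
  have hν : (0 : ℝ) ≤ (nu h : ℝ) ^ τ.1 := by positivity
  exact mul_le_mul (mul_le_mul_of_nonneg_left h1 hν) h2 (by positivity) (by positivity)

end SetupQ

end Summit.ABC.StewartYu

end
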